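import Literature.Analysis.FluidPDE.VectorCalculus
import Literature.Analysis.FluidPDE.AxisymNoSwirlVorticity

/-!
# Columnar alignment zero (selfsim LEMMA C, C2; planner R12 for straight parallel families)

Cell `ns-blowup`, memo `selfsim/HEREDITY.md` §1 (C2). WHAT THIS IS NOT: not a statement about
Navier–Stokes dynamics; a pointwise kinematic identity for the tree's `FluidPDE.curl`.

A level of the tower is COLUMNAR (rank 1) at a point `x` when its velocity gradient there has the
block structure of a `z`-independent horizontal flow plus the parent's axial strain: the horizontal
velocity does not vary along the column axis (`∂_z v_x = ∂_z v_y = 0`) and the axial velocity does not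
vary across it (`∂_x v_z = ∂_y v_z = 0`).  Then the vorticity is VERTICAL (`(curl v)_x = (curl v)_y = 0`)
and therefore has zero component along EVERY horizontal direction — in particular along the strong
stretching direction `e₊ ⊥ ẑ` of any of the level's own off-core critical lines (memo C1): the level
delivers no aligned flux of its own to its children (ALIGNMENT ZERO).
-/

open WithLp Matrix
open scoped RealInnerProductSpace

namespace Summit.NavierStokesRegularity.FluidComputer.ColumnarAlignmentZero

open Literature.Analysis.FluidPDE


/-- Component `0` of the tree's curl: `(curl v)_0 = ∂₁v₂ − ∂₂v₁`. -/
theorem curl_apply_zero (v : EuclideanSpace ℝ (Fin 3) → EuclideanSpace ℝ (Fin 3)) (x : EuclideanSpace ℝ (Fin 3)) :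
    curl v x 0 = fderiv ℝ v x (EuclideanSpace.single 1 1) 2 - fderiv ℝ v x (EuclideanSpace.single 2 1) 1 := by
  simp [curl]

/-- Component `1` of the tree's curl: `(curl v)_1 = ∂₂v₀ − ∂₀v₂`. -/
theorem curl_apply_one (v : EuclideanSpace ℝ (Fin 3) → EuclideanSpace ℝ (Fin 3)) (x : EuclideanSpace ℝ (Fin 3)) :
    curl v x 1 = fderiv ℝ v x (EuclideanSpace.single 2 1) 0 - fderiv ℝ v x (EuclideanSpace.single 0 1) 2 := by
  simp [curl]

-- (`curl_apply_two` is `Literature.Analysis.FluidPDE.curl_apply_two`, AxisymNoSwirlVorticity.)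

/-- COLUMNAR ⇒ VERTICAL VORTICITY (memo §1 C2): under the columnar block structure of the velocity
gradient at `x` (axis `= e₂`), the two horizontal components of `curl v x` vanish. -/
theorem columnar_curl_horizontal_zero (v : EuclideanSpace ℝ (Fin 3) → EuclideanSpace ℝ (Fin 3)) (x : EuclideanSpace ℝ (Fin 3))
    (hzx : fderiv ℝ v x (EuclideanSpace.single 2 1) 0 = 0)
    (hzy : fderiv ℝ v x (EuclideanSpace.single 2 1) 1 = 0)
    (hxz : fderiv ℝ v x (EuclideanSpace.single 0 1) 2 = 0)
    (hyz : fderiv ℝ v x (EuclideanSpace.single 1 1) 2 = 0) :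
    curl v x 0 = 0 ∧ curl v x 1 = 0 := by
  refine ⟨?_, ?_⟩
  · rw [curl_apply_zero, hyz, hzy, sub_zero]
  · rw [curl_apply_one, hzx, hxz, sub_zero]

/-- ALIGNMENT ZERO (memo §1 C2 = planner R12 for rank-1 levels): a columnar level's vorticity has zero
component along every HORIZONTAL direction `e` (`e₂ = 0`) — in particular along the strong stretching
direction `e₊` of each of its own off-core critical lines, which is horizontal by memo C1. -/
theorem columnar_alignment_zero (v : EuclideanSpace ℝ (Fin 3) → EuclideanSpace ℝ (Fin 3)) (x e : EuclideanSpace ℝ (Fin 3))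
    (hzx : fderiv ℝ v x (EuclideanSpace.single 2 1) 0 = 0)
    (hzy : fderiv ℝ v x (EuclideanSpace.single 2 1) 1 = 0)
    (hxz : fderiv ℝ v x (EuclideanSpace.single 0 1) 2 = 0)
    (hyz : fderiv ℝ v x (EuclideanSpace.single 1 1) 2 = 0)
    (he : e 2 = 0) :
    ⟪curl v x, e⟫ = 0 := by
  obtain ⟨h0, h1⟩ := columnar_curl_horizontal_zero v x hzx hzy hxz hyz
  rw [EuclideanSpace.inner_eq_star_dotProduct]
  simp [dotProduct, Fin.sum_univ_three, h0, h1, he]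

/-- The tilting term cannot repair it (memo §1 C2): for vertical vorticity `ω = (0,0,ζ)` the vortex
stretching/tilting vector `(ω·∇)v = ζ ∂_z v` is again vertical under the columnar structure
(`∂_z v_x = ∂_z v_y = 0`), so no horizontal vorticity is generated inside the class. -/
theorem columnar_tilting_vertical (v : EuclideanSpace ℝ (Fin 3) → EuclideanSpace ℝ (Fin 3)) (x : EuclideanSpace ℝ (Fin 3)) (ζ : ℝ)
    (hzx : fderiv ℝ v x (EuclideanSpace.single 2 1) 0 = 0)
    (hzy : fderiv ℝ v x (EuclideanSpace.single 2 1) 1 = 0) :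
    (ζ • fderiv ℝ v x (EuclideanSpace.single 2 1)) 0 = 0 ∧
      (ζ • fderiv ℝ v x (EuclideanSpace.single 2 1)) 1 = 0 := by
  constructor <;> simp [hzx, hzy]

end Summit.NavierStokesRegularity.FluidComputer.ColumnarAlignmentZero
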